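import Mathlib
import HarnessLib
import Summits.ValiantsHypothesis.ValiantsHypothesis.Theses.MonotoneRestoration
import Literature.Computability.AlgebraicComplexity.SymmetricArithCircuit

/-! # Route MonotoneRestoration — crux `MonotoneRestorationQP`, line Sketch, stub N1
(stmt-ValiantsHypothesis-15886)

**Coefficients live in the algebra of constants.** For a Dawar–Wilsenach labelled arithmetic
circuit `C` over `ℂ` (`LabelledArithCircuit ℂ X Y G`), every coefficient of the polynomial
`C.eval g` computed at any gate `g` lies in the `ℚ`-subalgebra `S` of `ℂ` generated by the
constants labelling the constant gates of `C`.

Proof: by well-founded induction along the wires, every gate value lies in the range of the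
coefficient-wise embedding
`MvPolynomial.map (algebraMap S ℂ) : MvPolynomial X S →+* MvPolynomial X ℂ` (a subsemiring): a
variable gate is `X x = map _ (X x)`, a constant gate is `C c = map _ (C ⟨c, _⟩)` with `c ∈ S` a
generator, and addition / multiplication gates are finite sums / products of the values of their
children. The coefficients of a polynomial in that range are values of
`algebraMap S ℂ`, i.e. elements of `S` (`MvPolynomial.coeff_map`). This is the first step (N1) of
the dimension-counting size lower bound of cycle 2.
-/

noncomputable section

-- `Summit.ValiantsHypothesis.ValiantsHypothesis.…` is the tree's mandated namespace (Sub = Summit).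
set_option linter.dupNamespace false

namespace Summit.ValiantsHypothesis.ValiantsHypothesis.Theorems

open Literature.Computability.AlgebraicComplexity

/-- **N1 — coefficients live in the algebra of constants** (crux `MonotoneRestorationQP`, line
Sketch; registered stub `stub_coeff_mem_adjoin_constants`): every coefficient of the polynomial
computed at any gate `g` of a labelled arithmetic circuit `C` over `ℂ` lies in the `ℚ`-subalgebra
of `ℂ` generated by the constants labelling the constant gates of `C`. Well-founded induction along
the wires: every gate value is the coefficient-wise image of a polynomial with coefficients in that
subalgebra (variables contribute `X x`, constant gates generators, `+`/`×` gates finite sums and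
products). [folklore] -/
theorem stub_coeff_mem_adjoin_constants {X Y G : Type} (C : LabelledArithCircuit ℂ X Y G) (g : G)
    (m : X →₀ ℕ) :
    MvPolynomial.coeff m (C.eval g) ∈
      Algebra.adjoin ℚ {c : ℂ | ∃ g' : G, C.label g' = CircuitLabel.const c} := by
  set S : Subalgebra ℚ ℂ := Algebra.adjoin ℚ {c : ℂ | ∃ g' : G, C.label g' = CircuitLabel.const c}
  -- Every gate value is the coefficient-wise image of a polynomial with coefficients in `S`.
  suffices h : ∀ g : G, C.eval g ∈
      (MvPolynomial.map (algebraMap S ℂ) : MvPolynomial X S →+* MvPolynomial X ℂ).rangeS by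
    obtain ⟨p, hp⟩ := RingHom.mem_rangeS.1 (h g)
    rw [← hp, MvPolynomial.coeff_map, Subalgebra.algebraMap_apply]
    exact (MvPolynomial.coeff m p).2
  intro g
  induction g using C.wf.induction with
  | h g ih =>
    rcases hl : C.label g with x | c | _ | _
    · rw [C.eval_of_label_var hl]
      exact RingHom.mem_rangeS.2 ⟨MvPolynomial.X x, MvPolynomial.map_X _ x⟩
    · rw [C.eval_of_label_const hl]
      exact RingHom.mem_rangeS.2
        ⟨MvPolynomial.C ⟨c, Algebra.subset_adjoin ⟨g, hl⟩⟩, MvPolynomial.map_C _ _⟩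
    · rw [C.eval_of_label_add hl]
      exact sum_mem fun h hh => ih h hh
    · rw [C.eval_of_label_mul hl]
      exact prod_mem fun h hh => ih h hh

end Summit.ValiantsHypothesis.ValiantsHypothesis.Theorems

end
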